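import Summits.ValiantsHypothesis.ValiantsHypothesis.Theorems.KPlusLogSqLawTropicalBExchangeSquare
import Summits.ValiantsHypothesis.ValiantsHypothesis.Theorems.KPlusLogSqLawTropicalBStaticFour

/-!
# Route `KPlusLogSqLaw`, crux `TropicalB` — the STATIC `4 × 4` cell is at most `17` terms:
# static halving (`18`, `StaticHalving.static_row_four`) is NOT tight at size `4`

HONEST FRAMING.  Helper file toward the registered stubs of `Cruxes/TropicalB/Lines/birth.lean` (crux
`Summit.ValiantsHypothesis.ValiantsHypothesis.Theses.KPlusLogSqLaw.TropicalB`, ledger item `stmt-ValiantsHypothesis-19771`, route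
`KPlusLogSqLaw`; cell `pub-symmetroid`, seat `val-sym-trop-p4` g7, 2026-08-27).  ONE finite census cell of the STATIC tropical census
(integer parametric ASSIGNMENT instances of size `4` = affine lines through the normal fan of the Birkhoff polytope `B₄`); nothing here bears on
`TropicalB` in its window, `WeakLifting`, DoorA26/DoorA34, `MatrixDescartes` (stmt-18050) or `VP ≠ VNP`.

THE ARGUMENT.  In a static design a dominant term is determined by its permutation, so an unsigned dominant chain of a static `4 × 4`
design is an injective family of permutations of `Fin 4`.  For a balanced column split `{a, b} | {c, d}` and a permutation `σ`, the four
permutations `σ, σ·(a b), σ·(c d), σ·(a b)(c d)` (the perfect matchings inside a pair of complementary `2 × 2` blocks) give four terms in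
the gluing pattern of the tree's EXCHANGE-SQUARE LAW `ExchangeSquare.not_dominant_split_square` (val-sym-trop-p5 g5, p493290): they are
never all dominant.  There are `18` such PARALLELOGRAM QUADS (`3` splits × `6` cosets), each permutation lies in `3` of them, and static
halving's `18 = 6 · 3` would need a dominant set meeting EVERY quad in exactly `3` corners, i.e. a `6`-element set of permutations meeting
every quad exactly once.  **No such transversal exists** (a `4⁶ = 4096`-case Boolean `decide` over one corner per coset of the first split;
pen-and-paper: a transversal is a system of representatives `v_g · g` of the Klein four-group `V₄ ◁ S₄`, the cross-parity conditions read
`v_g v_{g'} ∉ {e, ν(g' g⁻¹)}`, and `𝔽₂²`-bookkeeping leaves no choice for the third rotation).  Hence every `18` permutations of `Fin 4`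
contain a full quad (fibrewise counting over the cosets of the offending split), and

* `StaticFourQuad.static_row_four_sixteen : IsStatic ε → DesignRowD d v ε 16` — **a static `4 × 4` design has at most `17` dominant
  terms** (every `K`, unsigned ⇒ signed), against `18` from static halving and `15` attained (`StaticHalving.static_four_unsigned_fifteen`);
* `StaticFourQuad.tropRootLawAtStatic_four_sixteen (K) : TropRootLawAtStatic 4 K 16`;
* `StaticFourQuad.static_four_cell : TropRootLawAtStatic 4 16 16 ∧ ¬ TropRootLawAtStatic 4 16 11` — the static size-`4` cell of record is
  now `15 ≤ · ≤ 17` terms unsigned, `13 ≤ · ≤ 17` signed.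

The permutations of `Fin 4` are handled through an explicit table `P : Fin 24 → Equiv.Perm (Fin 4)` (lexicographic in
`(σ 0, σ 1, σ 2, σ 3)`, written as products of `Equiv.swap`s) kept as a `let` inside the one proof, so that the finite combinatorics is a
`decide` over `Fin 24` indices and the file declares no definitions.
[this seat; tables generated by `tools/genlean.py`, transversal number `7` checked independently by `tools/quads.py`]
-/

set_option linter.dupNamespace false
set_option autoImplicit false

namespace Summit.ValiantsHypothesis.ValiantsHypothesis.Theorems.KPlusLogSqLaw

open Summit.ValiantsHypothesis.ValiantsHypothesis.Theorems.MatrixDescartes.Negative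
open Summit.ValiantsHypothesis.ValiantsHypothesis.Theorems.LacunarySymmetroidMatrixDescartes
open Summit.ValiantsHypothesis.ValiantsHypothesis.Theorems.LacunarySymmetroidMatrixDescartes.TropicalCensus
open Finset

namespace StaticFourQuad

/-- **A static `4 × 4` design has at most `17` dominant terms** (unsigned chains: `DesignRowD d v ε 16`), whatever `K`:
static halving's `18` is not attained.  The proof carries the permutation table `P`, the three balanced column splits
(`spA | spB | spC | spD`), the `18` parallelogram quads `quad s k c` (corner `c` of coset `k` of split `s`; corners `1, 2, 3` = corner `0`
right-multiplied by `swap a b`, `swap c d`, both), the coset index `cos s i` and the split-`1`/split-`2` coset bitmasks `mask u c` of the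
corners of split `0` as local tables; every finite fact about them is a `decide`. -/
theorem static_row_four_sixteen {K : ℕ} (d : Fin K → ℕ) (v ε : Fin 4 → Fin 4 → Fin K → ℤ) (hs : IsStatic ε) :
    DesignRowD d v ε 16 := by
  -- ### tables
  let P : Fin 24 → Equiv.Perm (Fin 4) :=
    ![(1 : Equiv.Perm (Fin 4)), (Equiv.swap (2 : Fin 4) 3 : Equiv.Perm (Fin 4)), (Equiv.swap (1 : Fin 4) 2 : Equiv.Perm (Fin 4)), (Equiv.swap (1 : Fin 4) 2 * Equiv.swap (2 : Fin 4) 3 : Equiv.Perm (Fin 4)), (Equiv.swap (1 : Fin 4) 2 * Equiv.swap (1 : Fin 4) 3 : Equiv.Perm (Fin 4)), (Equiv.swap (1 : Fin 4) 3 : Equiv.Perm (Fin 4)), (Equiv.swap (0 : Fin 4) 1 : Equiv.Perm (Fin 4)), (Equiv.swap (0 : Fin 4) 1 * Equiv.swap (2 : Fin 4) 3 : Equiv.Perm (Fin 4)), (Equiv.swap (0 : Fin 4) 1 * Equiv.swap (1 : Fin 4) 2 : Equiv.Perm (Fin 4)), (Equiv.swap (0 : Fin 4) 1 * Equiv.swap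 (1 : Fin 4) 2 * Equiv.swap (2 : Fin 4) 3 : Equiv.Perm (Fin 4)), (Equiv.swap (0 : Fin 4) 1 * Equiv.swap (1 : Fin 4) 2 * Equiv.swap (1 : Fin 4) 3 : Equiv.Perm (Fin 4)), (Equiv.swap (0 : Fin 4) 1 * Equiv.swap (1 : Fin 4) 3 : Equiv.Perm (Fin 4)), (Equiv.swap (0 : Fin 4) 1 * Equiv.swap (0 : Fin 4) 2 : Equiv.Perm (Fin 4)), (Equiv.swap (0 : Fin 4) 1 * Equiv.swap (0 : Fin 4) 2 * Equiv.swap (2 : Fin 4) 3 : Equiv.Perm (Fin 4)), (Equiv.swap (0 : Fin 4) 2 : Equiv.Perm (Fin 4)), (Equiv.swap (0 : Fin 4) 2 * Equiv.swap (2 : Fin 4) 3 : Equiv.Perm (Fin 4)), (Equiv.swap (0 : Fin 4) 2 * Equiv.swap (1 : Fin 4) 3 : Equiv.Perm (Fin 4)), (Equiv.swap (0 : Fin 4) 1 * Equiv.swap (0 : Fin 4) 2 * Equiv.swap (1 : Fin 4) 3 : Equiv.Perm (Fin 4)), (Equiv.swap (0 : Fin 4) 1 * Equiv.swap (0 : Fin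 4) 2 * Equiv.swap (0 : Fin 4) 3 : Equiv.Perm (Fin 4)), (Equiv.swap (0 : Fin 4) 1 * Equiv.swap (0 : Fin 4) 3 : Equiv.Perm (Fin 4)), (Equiv.swap (0 : Fin 4) 2 * Equiv.swap (0 : Fin 4) 3 : Equiv.Perm (Fin 4)), (Equiv.swap (0 : Fin 4) 3 : Equiv.Perm (Fin 4)), (Equiv.swap (0 : Fin 4) 1 * Equiv.swap (0 : Fin 4) 3 * Equiv.swap (1 : Fin 4) 2 : Equiv.Perm (Fin 4)), (Equiv.swap (0 : Fin 4) 3 * Equiv.swap (1 : Fin 4) 2 : Equiv.Perm (Fin 4))]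
  let spA : Fin 3 → Fin 4 := ![0, 0, 0]
  let spB : Fin 3 → Fin 4 := ![1, 2, 3]
  let spC : Fin 3 → Fin 4 := ![2, 1, 1]
  let spD : Fin 3 → Fin 4 := ![3, 3, 2]
  let quad : Fin 3 → Fin 6 → Fin 4 → Fin 24 :=
    ![![![(0 : Fin 24), (6 : Fin 24), (1 : Fin 24), (7 : Fin 24)], ![(2 : Fin 24), (12 : Fin 24), (3 : Fin 24), (13 : Fin 24)], ![(4 : Fin 24), (18 : Fin 24), (5 : Fin 24), (19 : Fin 24)], ![(8 : Fin 24), (14 : Fin 24), (9 : Fin 24), (15 : Fin 24)], ![(10 : Fin 24), (20 : Fin 24), (11 : Fin 24), (21 : Fin 24)], ![(16 : Fin 24), (22 : Fin 24), (17 : Fin 24), (23 : Fin 24)]], ![![(0 : Fin 24), (14 : Fin 24), (5 : Fin 24), (16 : Fin 24)], ![(1 : Fin 24), (20 : Fin 24), (3 : Fin 24), (22 : Fin 24)], ![(2 : Fin 24), (8 : Fin 24), (4 : Fin 24), (10 : Fin 24)], ![(6 : Fin 24), (12 : Fin 24), (11 : Fin 24), (17 : Fin 24)], ![(7 : Fin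 24), (18 : Fin 24), (9 : Fin 24), (23 : Fin 24)], ![(13 : Fin 24), (19 : Fin 24), (15 : Fin 24), (21 : Fin 24)]], ![![(0 : Fin 24), (21 : Fin 24), (2 : Fin 24), (23 : Fin 24)], ![(1 : Fin 24), (15 : Fin 24), (4 : Fin 24), (17 : Fin 24)], ![(3 : Fin 24), (9 : Fin 24), (5 : Fin 24), (11 : Fin 24)], ![(6 : Fin 24), (19 : Fin 24), (8 : Fin 24), (22 : Fin 24)], ![(7 : Fin 24), (13 : Fin 24), (10 : Fin 24), (16 : Fin 24)], ![(12 : Fin 24), (18 : Fin 24), (14 : Fin 24), (20 : Fin 24)]]]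
  let cos : Fin 3 → Fin 24 → Fin 6 :=
    ![![(0 : Fin 6), (0 : Fin 6), (1 : Fin 6), (1 : Fin 6), (2 : Fin 6), (2 : Fin 6), (0 : Fin 6), (0 : Fin 6), (3 : Fin 6), (3 : Fin 6), (4 : Fin 6), (4 : Fin 6), (1 : Fin 6), (1 : Fin 6), (3 : Fin 6), (3 : Fin 6), (5 : Fin 6), (5 : Fin 6), (2 : Fin 6), (2 : Fin 6), (4 : Fin 6), (4 : Fin 6), (5 : Fin 6), (5 : Fin 6)], ![(0 : Fin 6), (1 : Fin 6), (2 : Fin 6), (1 : Fin 6), (2 : Fin 6), (0 : Fin 6), (3 : Fin 6), (4 : Fin 6), (2 : Fin 6), (4 : Fin 6), (2 : Fin 6), (3 : Fin 6), (3 : Fin 6), (5 : Fin 6), (0 : Fin 6), (5 : Fin 6), (0 : Fin 6), (3 : Fin 6), (4 : Fin 6), (5 : Fin 6), (1 : Fin 6), (5 : Fin 6), (1 : Fin 6), (4 : Fin 6)], ![(0 : Fin 6), (1 : Fin 6), (0 : Fin 6), (2 : Fin 6), (1 : Fin 6), (2 : Fin 6), (3 : Fin 6), (4 : Fin 6), (3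 : Fin 6), (2 : Fin 6), (4 : Fin 6), (2 : Fin 6), (5 : Fin 6), (4 : Fin 6), (5 : Fin 6), (1 : Fin 6), (4 : Fin 6), (1 : Fin 6), (5 : Fin 6), (3 : Fin 6), (5 : Fin 6), (0 : Fin 6), (3 : Fin 6), (0 : Fin 6)]]
  let mask : Fin 6 → Fin 4 → ℕ :=
    ![![(65 : ℕ), (520 : ℕ), (130 : ℕ), (1040 : ℕ)], ![(68 : ℕ), (2056 : ℕ), (258 : ℕ), (1056 : ℕ)], ![(132 : ℕ), (2064 : ℕ), (257 : ℕ), (544 : ℕ)], ![(516 : ℕ), (2049 : ℕ), (272 : ℕ), (160 : ℕ)], ![(1028 : ℕ), (2050 : ℕ), (264 : ℕ), (96 : ℕ)], ![(1025 : ℕ), (514 : ℕ), (136 : ℕ), (80 : ℕ)]]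
  let meet : Fin 6 → Fin 6 → Fin 4 → Fin 4 → Bool := fun u w c c' => Nat.land (mask u c) (mask w c') != 0
  -- ### finite facts (all by `decide`)
  have P_surj : ∀ σ : Equiv.Perm (Fin 4), ∃ i : Fin 24, P i = σ := by decide
  have quad_spec : ∀ s k, P (quad s k 1) = P (quad s k 0) * Equiv.swap (spA s) (spB s) ∧
      P (quad s k 2) = P (quad s k 0) * Equiv.swap (spC s) (spD s) ∧
      P (quad s k 3) = P (quad s k 0) * Equiv.swap (spA s) (spB s) * Equiv.swap (spC s) (spD s) := by decide
  have cos_quad : ∀ s k c, cos s (quad s k c) = k := by decide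
  have quad_injective : ∀ s k c c', quad s k c = quad s k c' → c = c' := by decide
  have card_coset : ∀ (s : Fin 3) (k : Fin 6), #({i ∈ (univ : Finset (Fin 24)) | cos s i = k}) = 4 := by decide
  have split_facts : ∀ s : Fin 3, spA s ≠ spC s ∧ spA s ≠ spD s ∧ spB s ≠ spC s ∧ spB s ≠ spD s ∧
      ∀ i : Fin 4, i ≠ spA s → i ≠ spB s →
        Equiv.swap (spC s) (spD s) i ≠ spA s ∧ Equiv.swap (spC s) (spD s) i ≠ spB s := by decide
  have mask_spec : ∀ (u w : Fin 6) (c c' : Fin 4), meet u w c c' = true →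
      ∃ s : Fin 3, cos s (quad 0 u c) = cos s (quad 0 w c') := by decide
  -- no 6-element transversal of the 18 quads: one corner per coset of split 0 always puts two corners in a common coset of split 1 or 2
  have masks_meet : ∀ j₀ j₁ j₂ j₃ j₄ j₅ : Fin 4,
      (meet 0 1 j₀ j₁ || (meet 0 2 j₀ j₂ || (meet 0 3 j₀ j₃ || (meet 0 4 j₀ j₄ || (meet 0 5 j₀ j₅ || (meet 1 2 j₁ j₂ || (meet 1 3 j₁ j₃ || (meet 1 4 j₁ j₄ || (meet 1 5 j₁ j₅ || (meet 2 3 j₂ j₃ || (meet 2 4 j₂ j₄ || (meet 2 5 j₂ j₅ || (meet 3 4 j₃ j₄ || (meet 3 5 j₃ j₅ || (meet 4 5 j₄ j₅))))))))))))))) = true := by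
    decide
  -- ### the index of a permutation
  let code : Equiv.Perm (Fin 4) → Fin 24 := fun σ => Fin.find (fun i => P i = σ) (P_surj σ)
  have P_code : ∀ σ, P (code σ) = σ := fun σ => Fin.find_spec (p := fun i => P i = σ) (P_surj σ)
  have code_injective : Function.Injective code := fun σ τ h => by rw [← P_code σ, ← P_code τ, h]
  -- ### every 18 permutations contain a full quad
  have two_in_common_coset : ∀ j : Fin 6 → Fin 4, ∃ u w : Fin 6, u ≠ w ∧
      ∃ s : Fin 3, cos s (quad 0 u (j u)) = cos s (quad 0 w (j w)) := by
    intro j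
    have h0 := masks_meet (j 0) (j 1) (j 2) (j 3) (j 4) (j 5)
    simp only [Bool.or_eq_true] at h0
    obtain h | h | h | h | h | h | h | h | h | h | h | h | h | h | h := h0
    exacts [⟨0, 1, by decide, mask_spec _ _ _ _ h⟩,
      ⟨0, 2, by decide, mask_spec _ _ _ _ h⟩,
      ⟨0, 3, by decide, mask_spec _ _ _ _ h⟩,
      ⟨0, 4, by decide, mask_spec _ _ _ _ h⟩,
      ⟨0, 5, by decide, mask_spec _ _ _ _ h⟩,
      ⟨1, 2, by decide, mask_spec _ _ _ _ h⟩,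
      ⟨1, 3, by decide, mask_spec _ _ _ _ h⟩,
      ⟨1, 4, by decide, mask_spec _ _ _ _ h⟩,
      ⟨1, 5, by decide, mask_spec _ _ _ _ h⟩,
      ⟨2, 3, by decide, mask_spec _ _ _ _ h⟩,
      ⟨2, 4, by decide, mask_spec _ _ _ _ h⟩,
      ⟨2, 5, by decide, mask_spec _ _ _ _ h⟩,
      ⟨3, 4, by decide, mask_spec _ _ _ _ h⟩,
      ⟨3, 5, by decide, mask_spec _ _ _ _ h⟩,
      ⟨4, 5, by decide, mask_spec _ _ _ _ h⟩]
  have exists_full_quad : ∀ S : Finset (Fin 24), 18 ≤ #S → ∃ s k, ∀ c, quad s k c ∈ S := by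
    intro S hS
    by_contra h
    push Not at h
    choose j hj using h
    obtain ⟨u, w, huw, s, hcos⟩ := two_in_common_coset (j 0)
    have hx : quad 0 u (j 0 u) ∉ S := hj 0 u
    have hy : quad 0 w (j 0 w) ∉ S := hj 0 w
    have hxy : quad 0 w (j 0 w) ≠ quad 0 u (j 0 u) := by
      intro e
      have h1 : cos 0 (quad 0 w (j 0 w)) = cos 0 (quad 0 u (j 0 u)) := by rw [e]
      rw [cos_quad, cos_quad] at h1
      exact huw h1.symm
    have hmaps : ((S : Set (Fin 24))).MapsTo (cos s) ((univ : Finset (Fin 6)) : Set (Fin 6)) :=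
      fun _ _ => mem_coe.2 (mem_univ _)
    have hsum := card_eq_sum_card_fiberwise hmaps
    -- every fibre has at most three elements (its coset misses `quad s k (j s k)`)
    have hfib : ∀ k : Fin 6, #({i ∈ S | cos s i = k}) ≤ 3 := by
      intro k
      have hsub : {i ∈ S | cos s i = k} ⊆ ({i ∈ (univ : Finset (Fin 24)) | cos s i = k}).erase (quad s k (j s k)) := by
        intro i hi
        rw [mem_filter] at hi
        rw [mem_erase, mem_filter]
        exact ⟨fun e => hj s k (e ▸ hi.1), mem_univ _, hi.2⟩
      have hmem : quad s k (j s k) ∈ ({i ∈ (univ : Finset (Fin 24)) | cos s i = k}) := by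
        rw [mem_filter]; exact ⟨mem_univ _, cos_quad s k _⟩
      calc #({i ∈ S | cos s i = k}) ≤ #(({i ∈ (univ : Finset (Fin 24)) | cos s i = k}).erase (quad s k (j s k))) :=
            card_le_card hsub
        _ = 3 := by rw [card_erase_of_mem hmem, card_coset]
    -- the fibre of the coset containing the two chosen corners has at most two elements
    have hfib2 : #({i ∈ S | cos s i = cos s (quad 0 u (j 0 u))}) ≤ 2 := by
      have hsub : {i ∈ S | cos s i = cos s (quad 0 u (j 0 u))} ⊆
          (({i ∈ (univ : Finset (Fin 24)) | cos s i = cos s (quad 0 u (j 0 u))}).erase (quad 0 u (j 0 u))).erase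
            (quad 0 w (j 0 w)) := by
        intro i hi
        rw [mem_filter] at hi
        simp only [mem_erase, mem_filter, mem_univ, true_and]
        exact ⟨fun e => hy (e ▸ hi.1), fun e => hx (e ▸ hi.1), hi.2⟩
      have hxmem : quad 0 u (j 0 u) ∈ ({i ∈ (univ : Finset (Fin 24)) | cos s i = cos s (quad 0 u (j 0 u))}) := by
        rw [mem_filter]; exact ⟨mem_univ _, rfl⟩
      have hymem : quad 0 w (j 0 w) ∈
          ({i ∈ (univ : Finset (Fin 24)) | cos s i = cos s (quad 0 u (j 0 u))}).erase (quad 0 u (j 0 u)) := by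
        rw [mem_erase, mem_filter]; exact ⟨hxy, mem_univ _, hcos.symm⟩
      calc #({i ∈ S | cos s i = cos s (quad 0 u (j 0 u))})
          ≤ #((({i ∈ (univ : Finset (Fin 24)) | cos s i = cos s (quad 0 u (j 0 u))}).erase (quad 0 u (j 0 u))).erase
              (quad 0 w (j 0 w))) := card_le_card hsub
        _ = 2 := by rw [card_erase_of_mem hymem, card_erase_of_mem hxmem, card_coset]
    have hsplit := Finset.add_sum_erase (univ : Finset (Fin 6)) (fun k => #({i ∈ S | cos s i = k}))
      (mem_univ (cos s (quad 0 u (j 0 u))))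
    have hrest : ∑ k ∈ (univ : Finset (Fin 6)).erase (cos s (quad 0 u (j 0 u))), #({i ∈ S | cos s i = k}) ≤ 5 * 3 := by
      calc ∑ k ∈ (univ : Finset (Fin 6)).erase (cos s (quad 0 u (j 0 u))), #({i ∈ S | cos s i = k})
          ≤ ∑ k ∈ (univ : Finset (Fin 6)).erase (cos s (quad 0 u (j 0 u))), 3 := sum_le_sum fun k _ => hfib k
        _ = 5 * 3 := by rw [sum_const, card_erase_of_mem (mem_univ _), card_univ, Fintype.card_fin, smul_eq_mul]
    omega
  -- ### the chain
  intro n θ p hθ hdom hne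
  by_contra hn
  push Not at hn
  have hinj := injective_of_chainD d v ε θ p hθ hdom hne
  -- in a static design the class of a present term at a column is determined by its row there
  have hcl : ∀ (a b : Fin (n + 1)) (i : Fin 4), (p a).1 i = (p b).1 i → (p a).2 i = (p b).2 i := by
    intro a b i hab
    have ha := present_of_termSign_ne_zero ε (p a) (hdom a).1 i
    have hb := present_of_termSign_ne_zero ε (p b) (hdom b).1 i
    rw [hab] at ha
    exact hs _ _ _ _ ha hb
  have hperm : ∀ a b : Fin (n + 1), (p a).1 = (p b).1 → p a = p b := fun a b hab =>
    ExchangeSquare.term_eq_of_agree fun i => ⟨by rw [hab], hcl a b i (by rw [hab])⟩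
  let f : Fin (n + 1) → Fin 24 := fun k => code (p k).1
  have hf : Function.Injective f := fun a b hab => hinj (hperm a b (code_injective hab))
  have hS : 18 ≤ #((univ : Finset (Fin (n + 1))).image f) := by
    rw [card_image_of_injective _ hf, card_univ, Fintype.card_fin]; omega
  obtain ⟨s, k, hk⟩ := exists_full_quad _ hS
  have hget : ∀ c : Fin 4, ∃ kc : Fin (n + 1), f kc = quad s k c ∧ (p kc).1 = P (quad s k c) := by
    intro c
    obtain ⟨kc, -, hkc⟩ := mem_image.1 (hk c)
    exact ⟨kc, hkc, by rw [← hkc]; exact (P_code _).symm⟩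
  obtain ⟨k0, f0, h0⟩ := hget 0
  obtain ⟨k1, f1, h1⟩ := hget 1
  obtain ⟨k2, f2, h2⟩ := hget 2
  obtain ⟨k3, f3, h3⟩ := hget 3
  obtain ⟨q1, q2, q3⟩ := quad_spec s k
  obtain ⟨hac, had, hbc, hbd, hswap⟩ := split_facts s
  have e1 : (p k1).1 = (p k0).1 * Equiv.swap (spA s) (spB s) := by rw [h1, q1, h0]
  have e2 : (p k2).1 = (p k0).1 * Equiv.swap (spC s) (spD s) := by rw [h2, q2, h0]
  have e3 : (p k3).1 = (p k0).1 * Equiv.swap (spA s) (spB s) * Equiv.swap (spC s) (spD s) := by rw [h3, q3, h0]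
  have hne02 : p k0 ≠ p k2 := by
    intro e
    have h02 : f k0 = f k2 := by simp only [f, e]
    rw [f0, f2] at h02
    exact absurd (quad_injective s k 0 2 h02) (by decide)
  have hne01 : p k0 ≠ p k1 := by
    intro e
    have h01 : f k0 = f k1 := by simp only [f, e]
    rw [f0, f1] at h01
    exact absurd (quad_injective s k 0 1 h01) (by decide)
  have hmem : ∀ i : Fin 4, i ∈ ({spA s, spB s} : Finset (Fin 4)) ↔ i = spA s ∨ i = spB s := fun i => by
    rw [mem_insert, mem_singleton]
  refine ExchangeSquare.not_dominant_split_square d v ε ({spA s, spB s} : Finset (Fin 4))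
    (p₁₁ := p k0) (p₁₂ := p k2) (p₂₁ := p k1) (p₂₂ := p k3) ?_ ?_ ?_ ?_ hne02 hne01
    (hdom k0) (hdom k2) (hdom k1) (hdom k3)
  · -- on `{a, b}`: `σ` and `σ·(c d)` agree
    intro i hi
    have hia : i ≠ spC s ∧ i ≠ spD s := by
      rcases (hmem i).1 hi with rfl | rfl
      · exact ⟨hac, had⟩
      · exact ⟨hbc, hbd⟩
    have hrow : (p k0).1 i = (p k2).1 i := by
      rw [e2, Equiv.Perm.mul_apply, Equiv.swap_apply_of_ne_of_ne hia.1 hia.2]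
    exact ⟨hrow, hcl _ _ _ hrow⟩
  · -- on `{a, b}`: `σ·(a b)` and `σ·(a b)(c d)` agree
    intro i hi
    have hia : i ≠ spC s ∧ i ≠ spD s := by
      rcases (hmem i).1 hi with rfl | rfl
      · exact ⟨hac, had⟩
      · exact ⟨hbc, hbd⟩
    have hrow : (p k1).1 i = (p k3).1 i := by
      rw [e1, e3]
      simp only [Equiv.Perm.mul_apply]
      rw [Equiv.swap_apply_of_ne_of_ne hia.1 hia.2]
    exact ⟨hrow, hcl _ _ _ hrow⟩
  · -- off `{a, b}`: `σ` and `σ·(a b)` agree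
    intro i hi
    have hi' : i ≠ spA s ∧ i ≠ spB s := by
      constructor <;> (intro e; exact hi ((hmem i).2 (by simp [e])))
    have hrow : (p k0).1 i = (p k1).1 i := by
      rw [e1, Equiv.Perm.mul_apply, Equiv.swap_apply_of_ne_of_ne hi'.1 hi'.2]
    exact ⟨hrow, hcl _ _ _ hrow⟩
  · -- off `{a, b}`: `σ·(c d)` and `σ·(a b)(c d)` agree
    intro i hi
    have hi' : i ≠ spA s ∧ i ≠ spB s := by
      constructor <;> (intro e; exact hi ((hmem i).2 (by simp [e])))
    have hsw := hswap i hi'.1 hi'.2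
    have hrow : (p k2).1 i = (p k3).1 i := by
      rw [e2, e3]
      simp only [Equiv.Perm.mul_apply]
      rw [Equiv.swap_apply_of_ne_of_ne hsw.1 hsw.2]
    exact ⟨hrow, hcl _ _ _ hrow⟩

/-- **The static size-`4` tropical row is at most `16` breakpoints (`17` terms) for every `K`.** -/
theorem tropRootLawAtStatic_four_sixteen (K : ℕ) : TropRootLawAtStatic 4 K 16 :=
  fun d v ε _ θ p _ hs hθ hdom halt => le_of_designRowD (static_row_four_sixteen d v ε hs) θ p hθ hdom halt

/-- **The static size-`4` cell (signed currency), sharpened**: `TropRootLawAtStatic 4 16 16 ∧ ¬ TropRootLawAtStatic 4 16 11` — at most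
`17` terms (this file) and at least `13` sign-alternating terms (`StaticHalving.static_four_signed_thirteen`); unsigned `15 ≤ · ≤ 17`. -/
theorem static_four_cell : TropRootLawAtStatic 4 16 16 ∧ ¬ TropRootLawAtStatic 4 16 11 :=
  ⟨tropRootLawAtStatic_four_sixteen 16, fun h => absurd (StaticHalving.static_four_signed_thirteen h) (by norm_num)⟩

end StaticFourQuad

end Summit.ValiantsHypothesis.ValiantsHypothesis.Theorems.KPlusLogSqLaw
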